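import Summits.Parity.GeneralizedHardyLittlewood.Theses.LiouvilleMAD

/-! Census §6 probe: the re-rooted deciding theorem type-checks against the CURRENT `EngineToGHL` unchanged. -/

namespace Summit.Parity.GeneralizedHardyLittlewood.Cruxes.CosetDecorrelation.RerootProbe
open Summit.Parity.GeneralizedHardyLittlewood.Theses.LiouvilleMAD

/-- `closes` re-rooted at the node: the MAD cruxes are not hypotheses. -/
theorem closes_rerooted (h₄ : DilatedChowla) (hEH : ElliottHalberstam) (hX : EngineToGHL) :
    GeneralizedHardyLittlewood :=
  hX.2.2.2.2 (hX.2.2.2.1 (hX.2.2.1 (hX.2.1 h₄)) hEH)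

end Summit.Parity.GeneralizedHardyLittlewood.Cruxes.CosetDecorrelation.RerootProbe
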